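import Summits.QuantumFields.BalabanUV.Beta.D1BFx.AssemblyEndRecutS
import Summits.QuantumFields.BalabanUV.Beta.D1BFx.RoadEndBFxRecut

/-!
# `BalabanUV.Beta.D1BFx.RoadEndBFxRecutS` — road «BF-x» for binder row D1, END TO END OVER THE TWO-PROFILE RE-CUT REST TABLE AT THE FROZEN PROFILE OF
# RECORD, variant «ENDₛ» (END-ii-SPEC v1.1 §3 (b), chain link 2): `RoadEndBFxRecut.d1Drift_BFx_recut` with the loop-weight tie RESCALED by a displayed
# scalar family `s : ℕ → ℝ` (`hωs : ω_gh n·(s n·cK n)² = −2·ω_gl n·cE n²`) and the (REST′) words read from `restKS n a (gfrz n a b) (s n • gfrz n a b)` —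
# ghost tadpole ∕ ghost bubble words at the rescaled frozen profile; `s ≡ 1` is the END of record, `s n = n⁻²` is «END-ii»

HONEST DEPENDENCY (page 1, mandatory): continuum YM on T⁴ ⇐ BetaPertH ∧ nine spine estimates (0/9 proved); BetaPertH ⇐ (D1) ∧ (D4) ∧
CAP+tail; G-an2-4 gates asym, D1 and NE2/3/4.  HONEST FRAMING (cell contract, verbatim): «discharging `BetaPertH` makes Bałaban's UV
stability UNCONDITIONAL — a real constructive-QFT result; it is NOT the continuum limit and NOT the Clay problem.»  THIS MODULE DISCHARGES
NOTHING of the wall: [folklore] composition BY NAME of `RoadEnd.d1Drift_of_strongRoad` (leaf-07 + an3 C3) with `AssemblyEndRecutS.defect_le_at_recutS`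
along `n = Lc^m`, the corner word's bound (`CornerRest` ∕ `CornerSummable` ∕ `FrozenLegProfile`, unchanged: the corner word of `restKS` is the record's) and
the near rows of `gfrz`; what REMAINS displayed, by name — bridge B1 `hB1`; (K) `hK` + `hωs` + `hlam`; the (α)-leaf `Spr (Ga n a)`; the five slot-table
sockets; `hdiv`; `hrowgh`; the FAR rows h2∕d0∕d1∕d2 of `gfrz`; the per-word n-UNIFORM (REST′) bounds for the two-profile words other than the corner; (U).
No `def`, no `Prop` minted, nothing cited, 0 sorry.  0 wall binders discharged; NOT (K), NOT D1, NOT `BetaPertH`, NOT continuum, NOT Clay.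

ABSOLUTE RULE (cell charter, verbatim): «No internally-minted statement may enter as a cited fact. Every hypothesis is either kernel-proved in
this package or a verbatim quotation of a PUBLISHED theorem with page reference. The manuscript(s) under audit are NOT citable for their own
disputed steps — they are the thing under adjudication; programme-internal (2001/route/tribunal) claims are never citable.»

WHY (owner ruling ρ-g11-9; `END-ii-SPEC.md` v1.1; binder GO R-D1-g31-2 (b)).  Link 1 (`AssemblyEndRecutS`) put the rescaled tie and the two-profile REST
table into the defect bound at one block size; THIS FILE is the `∀ n` END over it — `RoadEndBFxRecut.d1Drift_BFx_recut` with exactly two edits: the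
hypothesis `hω` becomes `(s : ℕ → ℝ) (hωs : ∀ n ≥ 2, ω_gh n·(s n·cK n)² = −2·(ω_gl n·cE n²))`, and the (REST′) words are
`restKS n a (gfrz n a b) (fun v => s n * gfrz n a b v) …` (ghost ranges at the rescaled profile, every other range the record's word, rfl).  The files above
(`AssemblyEndTotalS`, `RoadEndBFxTotalS`, …, `RoadEndBFxWiredS`) continue the chain; `s n = ((n:ℝ)^2)⁻¹` is pinned only at its end.

CONTENT.
* §1 [folklore] **`rest_all_of_offCornerS`** — (REST′) for all two-profile words from the off-corner ones (the corner word is the record's: full sum `0`).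
* §2 [folklore] **`d1Drift_BFx_recutS`** — `D1Drift Lc Js N μ ν` from B1, (K) with `hωs`∕`hlam`, `Spr (Ga n a)`, the sockets, `hdiv`, `hrowgh`, the far rows of
  `gfrz`, (REST′) for `restKS (gfrz n a b) (s n • gfrz n a b)` off the corner, (U).
Unit `b2b-balaban-beta-d1-p2` (road owner, gen 12); `LEAVES-BFx.md` row A7-ENDₛ (chain link 2); END-ii-SPEC v1.1 §3 (b).
-/

noncomputable section

open Finset Filter Topology
open scoped BigOperators
open Literature.MathematicalPhysics.QuantumFieldTheory.Balaban1983to89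
open Literature.MathematicalPhysics.QuantumFieldTheory.Balaban1983to89.Beta
open OneStepResolventKernel (JetData)
open OneStepKernelFamily (TbalOf D1Drift)
open WindowIdentification (fullSum psum)
open B12Sec2to5 (l1)
open DyadicShell (Pt toReal supNorm)
open ExpKernelCalculus (Site MKer BiLoc shiftK)
open SquareTable (stK)
open GhostTable (gFree)
open SpinTable (bfKernel)
open BubbleTransfer (unitVec)
open DressedMomentNormalisation (resSite)
open Summit.QuantumFields.BalabanUV.Beta.TameKernelCalculus (Spr)
open Summit.QuantumFields.BalabanUV.Beta.D1BFx.GluonLeg (Ga)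
open Summit.QuantumFields.BalabanUV.Beta.D1BFx.ReducedKernel (TableR TOfRed)
open Summit.QuantumFields.BalabanUV.Beta.D1BFx.DressedTadpoleTable (tableRed)
open Summit.QuantumFields.BalabanUV.Beta.D1BFx.ReducedKernelSandwich (fineHess)
open Summit.QuantumFields.BalabanUV.Beta.D1BFx.FineStencilBFBalaban (SbfBal)
open Summit.QuantumFields.BalabanUV.Beta.D1BFx.SecondStencilBF (Wbf)
open Summit.QuantumFields.BalabanUV.Beta.D1BFx.GhostKernelComplete (PghQ fineHessGhQ)
open Summit.QuantumFields.BalabanUV.Beta.D1BFx.FrozenCorner (negAt)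
open Summit.QuantumFields.BalabanUV.Beta.D1BFx.FrozenLegProfile (gfrz gfrz_neg gfrz_negAt decay_gfrz abs_gfrz_sub_gFree_le abs_gfrz_diff_flat_le)
open Summit.QuantumFields.BalabanUV.Beta.D1BFx.SplitInstance (RestIdx)
open Summit.QuantumFields.BalabanUV.Beta.D1BFx.SplitRecut (restK' restK'_corner_eq)
open Summit.QuantumFields.BalabanUV.Beta.D1BFx.SplitInstanceS (restKS restKS_corner_eq)
open Summit.QuantumFields.BalabanUV.Beta.D1BFx.CornerRest (rest_corner_bound)
open Summit.QuantumFields.BalabanUV.Beta.D1BFx.CornerSummable (summable_weight₂_bfKernel summable_weight₁_bfKernel)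
open Summit.QuantumFields.BalabanUV.Beta.D1BFx.Assembly (sum_uniform_resSite)
open Summit.QuantumFields.BalabanUV.Beta.D1BFx.AssemblyEnd (hT_of_pointwise)
open Summit.QuantumFields.BalabanUV.Beta.D1BFx.AssemblyEndRecutS (defect_le_at_recutS)
open Summit.QuantumFields.BalabanUV.Beta.D1BFx.RoadEnd (d1Drift_of_strongRoad)
open Summit.QuantumFields.BalabanUV.Beta.D1BFx.RoadEndBFxRecut (cornerIdx rowConst gfrz₀ gfrz₀_eq rowConst_nonneg)

namespace Summit.QuantumFields.BalabanUV.Beta.D1BFx.RoadEndBFxRecutS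

/-! ## §1 (REST′) for every two-profile word from the off-corner words: the corner word is a theorem -/

section Rest

variable (n : ℕ) [NeZero n] (a : ℝ) (cE cΛ cR cK cQ cE₂ cJ4 cΛ₂ cR₂ cQ₂ x₀ ωgl ωgh N : ℝ) (WE WJ WΛ WR WQ : TableR) {μ ν : Fin 4} {CR : RestIdx → ℝ}

/-- [folklore] **THE (REST′) BOUNDS FOR ALL TWO-PROFILE RE-CUT WORDS FROM THE OFF-CORNER ONES** at the pinned normalisation `lam = n⁸`, the frozen profile
`gfrz n a` and ANY second (ghost) profile `g'`: the corner word is the record's (`restKS_corner_eq`), its base-point average has full sum `0`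
(`CornerRest.rest_corner_bound` + `gfrz_negAt` + `CornerSummable` ⟸ `Spr (Ga n a)`), so its constant is `0`. -/
theorem rest_all_of_offCornerS (hμν : μ ≠ ν) (hGa : Spr (Ga n a)) (g' : Pt → Pt → ℝ)
    (hRest : ∀ τ : RestIdx, τ ≠ cornerIdx →
      |∑ b ∈ (univ : Finset (Fin 4 → Fin n)).image resSite, ((n : ℝ) ^ 4)⁻¹ *
        fullSum (fun w : Pt => restKS n a (gfrz n a b) (g' b) cE cΛ cR cK cQ cE₂ cJ4 cΛ₂ cR₂ cQ₂ x₀ WE WJ WΛ WR WQ ωgl ωgh ((n : ℝ) ^ 8) N μ ν b τ w)|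
        ≤ CR τ) (τ : RestIdx) :
    |∑ b ∈ (univ : Finset (Fin 4 → Fin n)).image resSite, ((n : ℝ) ^ 4)⁻¹ *
        fullSum (fun w : Pt => restKS n a (gfrz n a b) (g' b) cE cΛ cR cK cQ cE₂ cJ4 cΛ₂ cR₂ cQ₂ x₀ WE WJ WΛ WR WQ ωgl ωgh ((n : ℝ) ^ 8) N μ ν b τ w)|
      ≤ (if τ = cornerIdx then 0 else CR τ) := by
  by_cases hτ : τ = cornerIdx
  · rw [if_pos hτ, hτ, cornerIdx]
    simp only [restKS_corner_eq, restK'_corner_eq]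
    have hn8 : ((n : ℝ) ^ 8)⁻¹ * (n : ℝ) ^ 8 = 1 := inv_mul_cancel₀ (pow_ne_zero 8 (Nat.cast_ne_zero.mpr (NeZero.ne n)))
    refine rest_corner_bound n a (gb := fun b => gfrz n a b) cE cΛ cR cK cQ cE₂ cJ4 cΛ₂ cR₂ cQ₂ x₀ WE WJ WΛ WR WQ ωgl ωgh ((n : ℝ) ^ 8) N hμν
      (fun b w => gfrz_negAt μ w) (fun b => ?_) (fun b => ?_) hn8
    · obtain ⟨C, δ', hδ', hgb⟩ := decay_gfrz hGa b
      exact summable_weight₂_bfKernel hδ' hgb N μ ν μ ν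
    · obtain ⟨C, δ', hδ', hgb⟩ := decay_gfrz hGa b
      exact summable_weight₁_bfKernel hδ' hgb N μ ν ν
  · rw [if_neg hτ]
    exact hRest τ hτ

end Rest

/-! ## §2 The road END over the two-profile re-cut table at the frozen profile of record -/

variable {Lc : ℕ} [NeZero Lc] {a N : ℝ} {μ ν : Fin 4} {υ : Type*} [Fintype υ]
  {cE cVH cΛ cR cK cQ cE₂ cJ4 cΛ₂ cR₂ cQ₂ x₀ ωgl ωgh : ℕ → ℝ} {WE WJ WΛ WR WQ : ℕ → TableR} {CE CJ CΛ CRt CQ δW : ℕ → ℝ}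
  {Ru : υ → ℕ → ℝ} {CU : υ → ℝ} {CR : RestIdx → ℝ} {A : ℕ → ℝ} {D₂ δ U₁ : ℝ}

/-- [folklore] **ROAD BF-x, END TO END, OVER THE TWO-PROFILE RE-CUT REST TABLE AT THE FROZEN PROFILE `gfrz`, variant «ENDₛ» (strong grading, odd blocking
factor).**  The wall's literal term `D1Drift Lc Js N μ ν` for ANY jet data `Js`, channel `μ ≠ ν`, `N ≠ 0`, from: bridge B1; the kernel representation (K) of the
one-shot coefficient with the RESCALED loop-weight tie `ω_gh n·(s n·cK n)² = −2·ω_gl n·cE n²` (displayed scalar family `s : ℕ → ℝ`; `s ≡ 1` = the END of record,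
`s n = n⁻²` = END-ii) and the normalisation `ω_gl n·cE n² = 2N²·n⁸`; the (α)-leaf `Spr (Ga n a)`; the slot-table sockets; `hdiv`; the ghost Ward rows; the FAR rows
h2∕d0∕d1∕d2 of `gfrz`; the per-word n-UNIFORM (REST′) bounds for the TWO-PROFILE re-cut words `restKS n a (gfrz n a b) (fun v => s n * gfrz n a b v) …` other
than the corner (ghost tadpole ∕ ghost bubble words at the rescaled profile `s n • gfrz n a b`); (U).  The near rows h0∕h1, the profile's exponential bound,
evenness and `R_μ`-invariance, (CONV) for every word and the corner word's bound are THEOREMS used inside. -/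
theorem d1Drift_BFx_recutS (Js : ℕ → JetData 3 Lc) (hμν : μ ≠ ν) (hN : N ≠ 0) (hL : 2 ≤ Lc) (hodd : Odd Lc) (ha : 0 < a) (c : ℕ → ℝ)
    (hD₂ : 0 ≤ D₂) (hA : ∀ j, 0 ≤ A j) (hδ : 0 < δ)
    -- the frozen profile's FAR rows (B5 Prop. 1.2 content)
    (h2 : ∀ n : ℕ, 2 ≤ n → ∀ [NeZero n], ∀ b ∈ (univ : Finset (Fin 4 → Fin n)).image resSite, ∀ v,
      |(gfrz n a b (v + unitVec ν + unitVec μ) - gFree (v + unitVec ν + unitVec μ)) - (gfrz n a b (v + unitVec ν) - gFree (v + unitVec ν)) -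
          (gfrz n a b (v + unitVec μ) - gFree (v + unitVec μ)) + (gfrz n a b v - gFree v)| ≤ D₂ / (n : ℝ) ^ 4)
    (d0 : ∀ n : ℕ, 2 ≤ n → ∀ [NeZero n], ∀ b ∈ (univ : Finset (Fin 4 → Fin n)).image resSite, ∀ v : Pt, v ≠ 0 →
      |gfrz n a b v| ≤ A 0 * Real.exp (-(δ / n) * supNorm v) / (supNorm v : ℝ) ^ 2)
    (d1 : ∀ n : ℕ, 2 ≤ n → ∀ [NeZero n], ∀ b ∈ (univ : Finset (Fin 4 → Fin n)).image resSite, ∀ v : Pt, v ≠ 0 → ∀ ρ : Fin 4,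
      |gfrz n a b (v + unitVec ρ) - gfrz n a b v| ≤ A 1 * Real.exp (-(δ / n) * supNorm v) / (supNorm v : ℝ) ^ 3)
    (d2 : ∀ n : ℕ, 2 ≤ n → ∀ [NeZero n], ∀ b ∈ (univ : Finset (Fin 4 → Fin n)).image resSite, ∀ v : Pt, v ≠ 0 →
      |gfrz n a b (v + unitVec ν + unitVec μ) - gfrz n a b (v + unitVec ν) - gfrz n a b (v + unitVec μ) + gfrz n a b v| ≤
        A 2 * Real.exp (-(δ / n) * supNorm v) / (supNorm v : ℝ) ^ 4)
    -- bridge B1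
    (hB1 : ∀ m : ℕ, 1 ≤ m → |(∑ j ∈ range m, B12Beta.secondMoment (TbalOf Lc Js j) μ ν) - c (Lc ^ m)| ≤ U₁)
    -- the (α)-leaf and slot (K) with the RESCALED loop-weight tie and the PINNED normalisation
    (hGa : ∀ n : ℕ, 2 ≤ n → ∀ [NeZero n], Spr (Ga n a))
    (hK : ∀ n : ℕ, 2 ≤ n → Odd n → ∀ [NeZero n], c n =
      ωgl n * B12Beta.secondMoment (TOfRed n a (SbfBal n a (cE n) (cVH n) (cΛ n) (cR n) (cK n) (cQ n))
        (tableRed n (Wbf (cE₂ n) (cJ4 n) (cΛ₂ n) (cR₂ n) (cQ₂ n) (WE n) (WJ n) (WΛ n) (WR n) (WQ n)))) μ ν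
      + ωgh n * B12Beta.secondMoment (PghQ n a (x₀ n) (cK n) (cQ n)) μ ν + ∑ u, Ru u n)
    (s : ℕ → ℝ) (hωs : ∀ n : ℕ, 2 ≤ n → ωgh n * (s n * cK n) ^ 2 = -2 * (ωgl n * cE n ^ 2))
    (hlam : ∀ n : ℕ, 2 ≤ n → ωgl n * cE n ^ 2 = 2 * N ^ 2 * (n : ℝ) ^ 8)
    -- slot-table sockets
    (hδW : ∀ n, 0 < δW n)
    (hE : ∀ n κ u l u', BiLoc (WE n κ u l u') u u' (CE n) (δW n)) (hJ : ∀ n κ u l u', BiLoc (WJ n κ u l u') u u' (CJ n) (δW n))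
    (hΛ : ∀ n κ u l u', BiLoc (WΛ n κ u l u') u u' (CΛ n) (δW n)) (hR : ∀ n κ u l u', BiLoc (WR n κ u l u') u u' (CRt n) (δW n))
    (hQ : ∀ n κ u l u', BiLoc (WQ n κ u l u') u u' (CQ n) (δW n))
    (hEc : ∀ (n : ℕ) (κ : Fin 4) (u : Site 4) (l : Fin 4) (u' t : Site 4),
      WE n κ (u + (n : ℤ) • t) l (u' + (n : ℤ) • t) = shiftK (-((n : ℤ) • t)) (WE n κ u l u'))
    (hJc : ∀ (n : ℕ) (κ : Fin 4) (u : Site 4) (l : Fin 4) (u' t : Site 4),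
      WJ n κ (u + (n : ℤ) • t) l (u' + (n : ℤ) • t) = shiftK (-((n : ℤ) • t)) (WJ n κ u l u'))
    (hΛc : ∀ (n : ℕ) (κ : Fin 4) (u : Site 4) (l : Fin 4) (u' t : Site 4),
      WΛ n κ (u + (n : ℤ) • t) l (u' + (n : ℤ) • t) = shiftK (-((n : ℤ) • t)) (WΛ n κ u l u'))
    (hRc : ∀ (n : ℕ) (κ : Fin 4) (u : Site 4) (l : Fin 4) (u' t : Site 4),
      WR n κ (u + (n : ℤ) • t) l (u' + (n : ℤ) • t) = shiftK (-((n : ℤ) • t)) (WR n κ u l u'))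
    (hQc : ∀ (n : ℕ) (κ : Fin 4) (u : Site 4) (l : Fin 4) (u' t : Site 4),
      WQ n κ (u + (n : ℤ) • t) l (u' + (n : ℤ) • t) = shiftK (-((n : ℤ) • t)) (WQ n κ u l u'))
    (hEs : ∀ n κ u l u', WE n κ u l u' = WE n l u' κ u) (hJs : ∀ n κ u l u', WJ n κ u l u' = WJ n l u' κ u)
    (hΛs : ∀ n κ u l u', WΛ n κ u l u' = WΛ n l u' κ u) (hRs : ∀ n κ u l u', WR n κ u l u' = WR n l u' κ u)
    (hQs : ∀ n κ u l u', WQ n κ u l u' = WQ n l u' κ u)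
    -- first-bond divergence-freeness of the gluon fine Hessian kernel; the ghost Ward rows
    (hdiv : ∀ n : ℕ, 2 ≤ n → ∀ [NeZero n], ∀ (l' : Fin 4) (u' u : Site 4), ∑ κ' : Fin 4,
      (fineHess n a (SbfBal n a (cE n) (cVH n) (cΛ n) (cR n) (cK n) (cQ n))
          (Wbf (cE₂ n) (cJ4 n) (cΛ₂ n) (cR₂ n) (cQ₂ n) (WE n) (WJ n) (WΛ n) (WR n) (WQ n)) κ' l' (u - Pi.single κ' 1) u'
        - fineHess n a (SbfBal n a (cE n) (cVH n) (cΛ n) (cR n) (cK n) (cQ n))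
          (Wbf (cE₂ n) (cJ4 n) (cΛ₂ n) (cR₂ n) (cQ₂ n) (WE n) (WJ n) (WΛ n) (WR n) (WQ n)) κ' l' u u') = 0)
    (hrowgh : ∀ n : ℕ, 2 ≤ n → ∀ [NeZero n], ∀ (κ' l' : Fin 4) (b : Site 4), HasSum (fineHessGhQ n a (x₀ n) (cK n) (cQ n) κ' l' b) 0)
    -- (REST′) for the two-profile re-cut words other than the corner, n-UNIFORM; (U)
    (hRest : ∀ n : ℕ, 2 ≤ n → ∀ [NeZero n], ∀ τ : RestIdx, τ ≠ cornerIdx →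
      |∑ b ∈ (univ : Finset (Fin 4 → Fin n)).image resSite, ((n : ℝ) ^ 4)⁻¹ *
        fullSum (fun w : Pt => restKS n a (gfrz n a b) (fun v => s n * gfrz n a b v) (cE n) (cΛ n) (cR n) (cK n) (cQ n) (cE₂ n) (cJ4 n)
          (cΛ₂ n) (cR₂ n) (cQ₂ n) (x₀ n) (WE n) (WJ n) (WΛ n) (WR n) (WQ n) (ωgl n) (ωgh n) ((n : ℝ) ^ 8) N μ ν b τ w)| ≤ CR τ)
    (hU : ∀ n : ℕ, 2 ≤ n → ∀ u, |Ru u n| ≤ CU u) :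
    D1Drift Lc Js N μ ν := by
  refine d1Drift_of_strongRoad Js hμν hN hL c (Bset := fun n => (univ : Finset (Fin 4 → Fin n)).image resSite)
    (wt := fun n _ => ((n : ℝ) ^ 4)⁻¹) (Gf := gfrz₀ a) (U₂ := (∑ u, CU u) + ∑ τ : RestIdx, (if τ = cornerIdx then 0 else CR τ))
    (D := rowConst a D₂) (A := A) (δ := δ)
    (rowConst_nonneg ha hD₂) hA hδ (fun n _ _ _ => by positivity) (fun n hn => sum_uniform_resSite (by omega)) ?_ ?_ ?_ ?_ ?_ ?_ hB1 ?_
  · -- h0, UNCONDITIONAL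
    intro n hn b _ v
    haveI : NeZero n := ⟨by omega⟩
    rw [gfrz₀_eq a n]
    exact abs_gfrz_sub_gFree_le n (le_trans one_le_two hn) ha b v
  · -- h1, UNCONDITIONAL
    intro n hn b _ v ρ
    haveI : NeZero n := ⟨by omega⟩
    rw [gfrz₀_eq a n]
    exact abs_gfrz_diff_flat_le n (le_trans one_le_two hn) ha b v ρ
  · -- h2
    intro n hn b hb v
    haveI : NeZero n := ⟨by omega⟩
    rw [gfrz₀_eq a n]
    exact h2 n hn b hb v
  · intro n hn b hb v hv
    haveI : NeZero n := ⟨by omega⟩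
    rw [gfrz₀_eq a n]
    exact d0 n hn b hb v hv
  · intro n hn b hb v hv ρ
    haveI : NeZero n := ⟨by omega⟩
    rw [gfrz₀_eq a n]
    exact d1 n hn b hb v hv ρ
  · intro n hn b hb v hv
    haveI : NeZero n := ⟨by omega⟩
    rw [gfrz₀_eq a n]
    exact d2 n hn b hb v hv
  -- the road's target `hT` along `n = Lc^m`
  refine hT_of_pointwise (c := c)
    (F := fun n => ∑ b ∈ (univ : Finset (Fin 4 → Fin n)).image resSite, ((n : ℝ) ^ 4)⁻¹ * fullSum (stK μ ν N (gfrz₀ a n b)))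
    (U := (∑ u, CU u) + ∑ τ : RestIdx, (if τ = cornerIdx then 0 else CR τ)) (fun n hn hon => ?_) hL hodd
  haveI : NeZero n := ⟨by omega⟩
  rw [gfrz₀_eq a n]
  exact defect_le_at_recutS n a (cE n) (cVH n) (cΛ n) (cR n) (cK n) (cQ n) (cE₂ n) (cJ4 n) (cΛ₂ n) (cR₂ n) (cQ₂ n) (x₀ n) (ωgl n) (ωgh n)
    ((n : ℝ) ^ 8) N (gp := gfrz n a) hn hon ha hμν (hGa n hn) (hK n hn hon) (s n) (hωs n hn) (hlam n hn) (hδW n) (hE n) (hJ n) (hΛ n) (hR n)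
    (hQ n) (hEc n) (hJc n) (hΛc n) (hRc n) (hQc n) (hEs n) (hJs n) (hΛs n) (hRs n) (hQs n) (hdiv n hn) (hrowgh n hn)
    (fun b => decay_gfrz (hGa n hn) b) (fun b w => gfrz_neg w)
    (rest_all_of_offCornerS n a (cE n) (cΛ n) (cR n) (cK n) (cQ n) (cE₂ n) (cJ4 n) (cΛ₂ n) (cR₂ n) (cQ₂ n) (x₀ n) (ωgl n) (ωgh n) N
      (WE n) (WJ n) (WΛ n) (WR n) (WQ n) hμν (hGa n hn) (fun b => fun v => s n * gfrz n a b v) (hRest n hn)) (hU n hn)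

end Summit.QuantumFields.BalabanUV.Beta.D1BFx.RoadEndBFxRecutS

end
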